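import Literature.AlgebraicGeometry.ModuliOfSheaves.KummerModuliSpacesOfSheaves
import HarnessLib
import HarnessLib.Audit

/-!
# OpenQuestionsKummerModuliSpaces — "the Kummer moduli spaces of sheaves `K_H(v)` are motivated by the abelian surface" (Floccari 2023 §1; Floccari–Fu–Zhang 2021 Rem. 3.5, 4.8), as typed CONJECTURES (obligations of `HodgeConjecture/HodgeConjecture`; nothing asserted)

HONEST FRAMING: typed ≠ proved ≠ endorsed.  Nothing in this file asserts `HodgeConjecture`, `HC_AV`,
`W₆`, `HC_Kum4Type`, `HC_KummerType` or either statement below; every `def … : Prop` here is an OPEN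
STATEMENT the cited authors leave open, typed in the tree's vocabulary so that the plan-novel ∕ lens
seats (`oqh`, `transfer`) and rung H3 of LADDER-HodgeAV ("HC for all projective HK of `Kumⁿ`-type,
`n ≥ 4`") consume STATEMENTS instead of prose.  Cross-ladder literature-typing layer D-0088(4), tranche
LT-H4 (open-question harvest), seat `hodge-lit-oqh-2` (gen 6); conjecture LEAF (nothing but `@[conjecture]`
definitions; imports `Literature.*` ∕ `HarnessLib` only).  Kernel glue (Arapura ⟹ the first statement
implies the second; `HC_KummerTypePowers` ⟹ the second) lives in the sibling
`Theorems/OpenQuestionsKummerModuliSpacesGlue.lean`.  Carriers: `Literature/AlgebraicGeometry/ModuliOfSheaves/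
KummerModuliSpacesOfSheaves.lean` (`ModuliOfSheaves.IsKummerSheafModuliSpace n A K` = Yoshioka's Albanese
fibre `K_H(v)` of a FINE moduli space `M_H(v)` of stable sheaves on the abelian surface `A` (a universal
family is part of the carrier `ModuliOfSheaves.AbelianSurfaceSheafModuli`), smooth projective of dimension
`2n` and of `Kumⁿ`-type; the KNOWN half — Bülles 2020: `M_H(v)` itself is motivated by `A` — and the
reduction to the Hodge conjecture are recorded there).  SCOPE (referee hodge-lit-oqh-1 g6, F-1): the
quantifier domain of both statements is therefore the sub-class of FINE moduli spaces (`M_H(v)` fine, e.g.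
`⟨v, v'⟩ = 1` for some Mukai vector `v'` — Huybrechts–Lehn Thm. 4.6.5 ∕ Cor. 4.6.7; always for
`v = (1, 0, -n-1)`, i.e. Beauville's `Kₙ(A)`) — FEWER varieties `K` than the printed expectation for all
`K_w(A,H)`, the safe (WEAKER) direction.

## Sources of record and what they leave open (read at source; locators = materialised arXiv texts)

* S. Floccari, *On the motive of O'Grady's six dimensional hyper-Kähler varieties*, Épijournal Géom.
  Algébrique 7 (2023) Art. 4 (arXiv:2203.16257) [`Floccari2023OG6Motive`; REFEREED], §1
  [corpus:paper:arxiv-2203.16257 p0002:L16–L18], verbatim: "By [Yos01], the Albanese map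
  `M_v(A,H) → A × Â` is an isotrivial fibration; we denote by `K_v(A,H)` the fibre of this morphism. When
  the effective Mukai vector `w` is primitive, the moduli space `M_w(A,H)` is a smooth and projective
  variety, and `K_w(A,H)` is a hyper-Kähler variety of generalized Kummer type (cf. [Yos01])."; and
  [p0002:L33–L37], verbatim: "Each of the varieties introduced above is expected to be motivated by the
  surface; this means that the rational Chow motive of such a variety should belong to the tensor
  subcategory generated by the motive of `A`.  For the smooth and projective moduli spaces `M_w(A,H)`
  associated to a primitive Mukai vector `w`, this has been confirmed by Bülles [Bue18]. […] **For the
  hyper-Kähler varieties `K_w(A,H)` and `K̃_v(A,H)`, however, the question remained open**; in this note we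
  deal with the OG6-type varieties `K̃_v(A,H)`." (Thm. 1 there settles `K̃_v`; `K_w(A,H)` stays open.)
* S. Floccari, L. Fu, Z. Zhang, *On the motive of O'Grady's ten-dimensional hyper-Kähler varieties*,
  Commun. Contemp. Math. 23 (2021) 2050034 (arXiv:1911.06572) [`FloccariFuZhang2021OG10Motive`; REFEREED],
  Remark 3.5 "Challenge for Kummer moduli spaces" [corpus:paper:arxiv-1911.06572 p0014:L1–L2]: "the moduli
  space `ℳ^st` is isotrivially fibered over `S × Ŝ` (which is the Albanese fibration when `ℳ^st` is
  projective). We usually denote by `𝒦^st` its fiber. The analogue of [Markman's] Theorem seems to be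
  unknown for `𝒦^st`"; Remark 4.8 "Motives of Kummer moduli spaces" [p0017:L20]: "Except for some special
  cases like generalized Kummer varieties (see [FTV19]), the analog[ues] of Proposition [4.5], Corollary
  [4.6] and Corollary [4.7] are unknown for those fibers in general. The missing ingredient is the
  analog[ue] of Markman's Theorem [the class of the diagonal of `M` lies in the subring generated by the
  Chern classes of universal sheaves]."
* Negative evidence that the question is still open (2026): S. Floccari, L. Fu, *The hyper-Kummer
  construction* (arXiv:2607.07528, July 2026; PREPRINT) Thm. 13.2 lists the hyperkähler varieties for which
  "`X` is motivated by `KS(X)`" is settled in homological motives — K3 ∕ `K3^{[n]}` on the `U³ ⊕ ⟨-a⟩`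
  locus, `Kum²`, `Kum³`, OG6-resolutions — and the Kummer moduli spaces of dimension `≥ 8` are not among
  them (tree records `Hyperkaehler.FloccariFu2026_kum2Kum3Type_isDominatedByPowers_discOneWeilFourfold`,
  `….k3HilbertType_transcendentalEmbedding_isDominatedByPowers_discOneWeilFourfold`).
* Known neighbours, BY NAME: `ModuliOfSheaves.Bulles2020_sheafModuli_isDominatedByPowers_surface` (the
  moduli space `M_H(v)` itself, K3 or abelian surface; Bülles, Manuscripta Math. 161 (2020) Thm. 0.1,
  REFEREED) with kernel `….hodgeConjectureFor_abelianSurface` (HC for `M_H(v)` on an abelian surface and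
  all its powers, modulo Bülles + Arapura); `Hyperkaehler.Xu2018_hodgeClasses_algebraic_generalizedKummerVariety`
  (Beauville's `Kₙ(A)` themselves = the Kummer moduli spaces of `v = (1, 0, -n-1)`, Yoshioka 2001 §4.1;
  Xu, IMRN 2018, Thm. 1.3, REFEREED); `HodgeTheory.hodgeConjectureFor_powSucc_of_surface` (a THEOREM of
  the tree: HC for every power of every abelian surface) — whence the REDUCTION
  `ModuliOfSheaves.IsKummerSheafModuliSpace.hodgeConjectureFor_of_isDominatedByPowers` (the first
  statement below implies the second, modulo `HodgeTheory.Arapura2006_hodgeClasses_algebraic_of_isDominatedByPowers`).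

## Which rung ∕ route each statement feeds (LADDER-HodgeAV)

* `KummerSheafModuliSpace_dominatedByAbelianSurface` → rung H3 through Arapura 2006 Lemma 4.2 (glue:
  `hc_kummerSheafModuliSpace_of_dominated`); `transfer` lens (transfer abelian SURFACE ⇝ HK `2n`-fold along
  the moduli construction; compare the `J³(X)`-fourfold transfer of `KummerType_dominatedByFourfoldPowers`).
  The printed obstruction ("missing ingredient": Markman's diagonal theorem for `K_H(v)`; the non-invariant
  classes under the group `A[n+1]` acting on `K_H(v)` are not reached by universal-sheaf classes) is the
  same invariant ∕ non-invariant split as the `Kum⁴` cell's `GammaInvariantsDominatedKum4` ∕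
  `Kum4NonInvariantClassesAlgebraic`.
* `HC_KummerSheafModuliSpace` → an INTERMEDIATE H3 rung: implied by `HC_KummerTypePowers` (glue), it is the
  Hodge conjecture on a countable union of `3`-dimensional loci — one for each realised pair (Mukai vector
  `v`, polarisation type); `3` = the dimension of the moduli of polarised abelian surfaces `(A, H)` — inside
  the `4`-dimensional moduli spaces of polarised `Kumⁿ`-type varieties (Yoshioka 2001 Thm. 0.2 (2): for
  `⟨v²⟩ ≥ 6` the period map `θ_v : v^⊥ → H²(K_H(v), ℤ)` is a Hodge isometry, so `ρ(K_H(v)) = ρ(A) + 1 ≥ 2`).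
  Which polarisation types of `Kumⁿ`-type varieties are realised by (birational models of) Kummer moduli
  spaces is a lattice question NOT addressed or claimed here (referee hodge-lit-oqh-1 g6, F-3); no density
  statement is made.

Grades: every cited status line carries REFEREED ∕ PREPRINT; this file's statements are OURS (typed
conjectures = the cohomological shadow of the authors' printed "expectation"), stated nowhere as theorems.
-/

noncomputable section

open Literature.AlgebraicGeometry Literature.AlgebraicGeometry.Motives
  Literature.AlgebraicGeometry.HodgeTheory Literature.AlgebraicGeometry.ModuliOfSheaves

-- `Summit.<Summit>.<Problem>` is the mandated summit-side namespace (CONVENTIONS §2); for the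
-- single-conjunct summit `HodgeConjecture` the two coincide, so the duplicate is deliberate.
set_option linter.dupNamespace false

namespace Summit.HodgeConjecture.HodgeConjecture.Theorems

/-- OPEN — **every Kummer moduli space of sheaves `K_H(v)` on a complex abelian surface `A` is
cohomologically dominated by the powers of `A`.**  For `2 ≤ n`, an abelian variety `A` and `K` with
`ModuliOfSheaves.IsKummerSheafModuliSpace n A K` (`K` ≅ an Albanese fibre of the smooth projective
`(2n+4)`-dimensional fine moduli space `M_H(v)` of `H`-stable sheaves on the abelian surface `A`, `K` smooth
projective of dimension `2n` and of `Kumⁿ`-type — Yoshioka 2001 Thm. 0.1–0.2): every `Hᵏ(K(ℂ); ℂ)` is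
spanned by images of algebraic correspondences from powers `Aᵉ` (`HodgeTheory.IsDominatedByPowers (2 * n) K
2 A.X`, Arapura 2006 Lemma 1.1 form).  This is the cohomological SHADOW of the printed expectation "the
rational Chow motive of `K_w(A,H)` should belong to the tensor subcategory generated by the motive of `A`"
(Floccari 2023 §1, "the question remained open"; Floccari–Fu–Zhang 2021 Rem. 4.8, "unknown for those fibers
in general … The missing ingredient is the analog[ue] of Markman's Theorem") — WEAKER than the Chow (or
homological) motivic statement, which implies it.  STATUS: OPEN for every `n ≥ 2` as a statement about
ALL `K_H(v)`; KNOWN for Beauville's `Kₙ(A) = K_H(1,0,-n-1)` (de Cataldo–Migliorini ∕ Xu 2018 Thm. 1.1 ∕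
Fu–Tian–Vial 2019, REFEREED — Chow motive in `⟨𝔥(A)⟩`); KNOWN for the ambient moduli space `M_H(v)`
(Bülles 2020 Thm. 0.1, tree record `ModuliOfSheaves.Bulles2020_sheafModuli_isDominatedByPowers_surface`).
Never asserted; with Arapura 2006 Lemma 4.2 it implies `HC_KummerSheafModuliSpace` (glue file, via
`ModuliOfSheaves.IsKummerSheafModuliSpace.hodgeConjectureFor_of_isDominatedByPowers`).
[cite: Floccari2023OG6Motive, §1 (arXiv:2203.16257 p. 2: "expected to be motivated by the surface … the question remained open")]
[cite: FloccariFuZhang2021OG10Motive, Remark 3.5 and Remark 4.8 (arXiv:1911.06572 pp. 14, 17)]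
[cite: Yoshioka2001AbelianSurfaces, Thm. 0.1 (1) and Thm. 0.2 (1) (the Albanese fibre K_H(v) is of Kummer type; journal §0 numbering — the arXiv:math/0009001 text prints them as Thm. 1.1 ∕ 1.2)]
[cite: Arapura2006, §1 Lemma 1.1 (domination ⟸ motivated)] -/
@[conjecture] def KummerSheafModuliSpace_dominatedByAbelianSurface : Prop :=
  ∀ (n : ℕ), 2 ≤ n → ∀ (A : AbelianVariety ℂ) ⦃K : SchemeOver ℂ⦄, IsKummerSheafModuliSpace n A K →
    IsDominatedByPowers (2 * n) K 2 A.X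

/-- OPEN (for `n ≥ 4`; THEOREM for `n = 2, 3` by the `Kumⁿ`-type results) — **the Hodge conjecture for every
Kummer moduli space of sheaves `K_H(v)` of `Kumⁿ`-type on a complex abelian surface, and for all its
powers.**  For `2 ≤ n`, `A` and `K` with `ModuliOfSheaves.IsKummerSheafModuliSpace n A K`: the tree's
per-variety Hodge statement for `K` in dimension `2n` and for every cartesian power `K^{m+1}` in dimension
`(m + 1) * (2 * n)`.  An INTERMEDIATE rung below `HC_KummerTypePowers` (every `K_H(v)` is a projective
`Kumⁿ`-type variety; glue `hc_kummerSheafModuliSpace_of_hc_kummerTypePowers`), above nothing typed; the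
natural consequence of "`K_H(v)` is motivated by `A`" (previous statement + Arapura 2006 Lemma 4.2 + the
tree's theorem `HodgeTheory.hodgeConjectureFor_powSucc_of_surface`; glue `hc_kummerSheafModuliSpace_of_dominated`).
STATUS: `n = 2` THEOREM (Floccari–Varesco, Math. Ann. 2025, Cor. 1.2, REFEREED, single variety; tree record
`Hyperkaehler.FloccariVaresco2024_hodgeClasses_algebraic_kum2Type`), `n = 3` PREPRINT theorem (Floccari
arXiv:2308.02267; tree `Hyperkaehler.Floccari2023_hodgeClasses_algebraic_kum3Type`), powers for `n = 2, 3`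
PREPRINT theorem (Floccari–Fu 2026 Thm. K (ii); tree
`Hyperkaehler.FloccariFu2026_kum2Kum3Type_isDominatedByPowers_discOneWeilFourfold.hodgeConjectureFor_powers`);
`n ≥ 4`: OPEN, no statement in print beyond the expectation above.  Never asserted; an explicit hypothesis
wherever used. [cite: Floccari2023OG6Motive, §1 (arXiv:2203.16257 p. 2)]
[cite: FloccariFuZhang2021OG10Motive, Remark 4.8] [cite: Yoshioka2001AbelianSurfaces, Thm. 0.2 (1)]
[cite: FloccariVaresco2024, Cor. 1.2 (n = 2)] -/
@[conjecture] def HC_KummerSheafModuliSpace : Prop :=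
  ∀ (n : ℕ), 2 ≤ n → ∀ (A : AbelianVariety ℂ) ⦃K : SchemeOver ℂ⦄, IsKummerSheafModuliSpace n A K →
    HodgeConjectureFor (2 * n) K ∧ ∀ m : ℕ, HodgeConjectureFor ((m + 1) * (2 * n)) (K.pow (m + 1))

end Summit.HodgeConjecture.HodgeConjecture.Theorems

end
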